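import Literature.IUT.HodgeTheaters.PuncturedEllipticCoveringsBasic
import Literature.IUT.HodgeTheaters.PuncturedEllipticCoveringsCuspRecovery
import Literature.IUT.HodgeTheaters.PuncturedEllipticCoveringsModel
import HarnessLib

/-!
# [IUTchI] Cor. 1.2, proof p. 39: the ramification of the ZERO cusp `ε⁰` in `X̲→ → X̲` — reduction and independence

Mochizuki, *Inter-universal Teichmüller theory I*, kurims manuscript (May 2020), §1, Corollary 1.2,
PROOF, p. 39 ([IUTchI] Cor 1.2 p.39): "The conjugacy classes of the decomposition groups of
`ε⁰, ε′, ε″` in `Π_X̲` may be recovered as the decomposition groups of cusps … whose image in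
`Gal(X̲→/X̲) = Π_X̲/Π_X̲→` is nontrivial" [claim: Mochizuki2012, status: disputed].

PROOF-ONLY companion (no definition, nothing restated, no consumer touched) of abc-iut-L5-t1's
`PuncturedEllipticCoverings.lean`, abc-iut-L5-d4's `PuncturedEllipticCoveringsCuspRecovery.lean` and the
consistency model `PuncturedEllipticCoveringsModel.lean`, written for the GAP-LEDGER row **G-L5d4g6-1**:
the clause for the ZERO cusp, `¬ D.inertia D.ε0 ≤ D.piXarrow` ("`ε⁰` is ramified in `X̲→ → X̲`"), is
today an explicit BINDER `h0`/`h0'` of `ofXarrow_of_anabelian`, `characteristicNatureOfCoverings_of_anabelian`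
(Cor12Assembly), `mem_triple_iff_of_map_decomp` (CuspTransport), `InitialThetaDataCor12Derived`.

* REDUCTION (`ArrowCoveringClaims.not_inertia_le_piXarrow_of_sup`, `…_ε0_…`): under the printed claims of
  p. 38 the binder follows from the printed-shape law "`I_{ε⁰} ↠ Δ_ε⁺`", i.e.
  `D.inertia D.ε0 ⊔ D.jKer = D.DeltaXbar` — the exact analogue for `ε⁰` of the typed clauses
  `inertia_ε1_sup`, `inertia_ε2_sup` of `ArrowCoveringClaims` — by the argument of
  `not_inertia_ε2_le_piXarrow` (`[Δ_X̲ : jKer] = l ≥ 5`).  In print this law holds because the product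
  of the cusp-inertia generators of `Δ_X̲` is a commutator and the involution `ι` fixes `ε⁰`, so that
  `I_{ε⁰} ≡ −(I_{ε′} + I_{ε″})` generates `Δ_ε⁺`; that geometric input is not carried by the typed record.
  CONVERSE (`ArrowCoveringClaims.inertia_sup_jKer_eq_of_not_le`): for PRIME `l` the binder is
  EQUIVALENT to the law (a subgroup strictly between `jKer` and `Δ_X̲` would have index dividing `l`).
* INDEPENDENCE (`TrivialModel.inertia_ε0_le_piXarrow`, `not_forall_not_inertia_ε0_le_piXarrow`): the
  consistency model `toyDatum` satisfies `ArrowCoveringClaims`, `Rmk121` AND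
  `CharacteristicNatureOfCoverings toyDatum toyDatum`, yet `I_{ε⁰} ≤ Π_{X→}` there (its `I_{ε⁰}` is
  trivial).  Hence the binder is NOT derivable from the frozen §1 record together with every typed
  printed claim of §1: the GAP row records a genuinely missing input (to be supplied as a law on the
  record or proved at the genuine datum from the étale `π₁`), not an unproved consequence.

HONEST SCOPE: kernel facts about the TYPED record; a separation witness refutes derivability from the
typed axioms, not the printed sentence; nothing here bears on [IUTchIII] Cor. 3.12; no side taken.
-/

namespace Literature.IUT.HodgeTheaters

namespace PuncturedEllipticData

universe u

variable {D : PuncturedEllipticData.{u}}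

/-! ### Reduction: the printed-shape law `I_x ⊔ jKer = Δ_X̲` forces ramification of `x` -/

/-- **Cor. 1.2, proof p. 39 (s6), reduction.** Under the printed claims of p. 38, a cusp `x` whose
inertia group generates `Δ_X̲` together with `jKer = Ker(Δ_X̲ ↠ Δ_ε⁺)` [i.e. `I_x ↠ Δ_ε⁺`] has inertia
group NOT contained in `Π_{X→}` [nontrivial image in `Gal(X̲→/X̲)`]: otherwise `I_x ⊆ Π_{X→} ∩ Δ_C = jKer`,
so `Δ_X̲ = jKer`, contradicting `[Δ_X̲ : jKer] = l ≥ 5`.  (The argument of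
`not_inertia_ε2_le_piXarrow`, stated for an arbitrary cusp.) ([IUTchI] Cor 1.2 p.39)
[claim: Mochizuki2012, status: disputed] -/
theorem ArrowCoveringClaims.not_inertia_le_piXarrow_of_sup (h : D.ArrowCoveringClaims) {x : D.Cusp}
    (hx : D.inertia x ⊔ D.jKer = D.DeltaXbar) : ¬ D.inertia x ≤ D.piXarrow := by
  intro hle
  have hj : D.inertia x ≤ D.jKer := by
    rw [← h.piXarrow_inf_delta]
    exact le_inf hle (inf_le_right : D.decomp x ⊓ D.DeltaC ≤ D.DeltaC)
  have hΔ : D.DeltaXbar = D.jKer := by rw [← hx]; exact sup_eq_right.mpr hj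
  have hl : D.jKer.relIndex D.DeltaXbar = 1 := by rw [hΔ, Subgroup.relIndex_self]
  rw [h.jKer_relindex] at hl
  have := D.five_le
  omega

/-- **Cor. 1.2, proof p. 39 (s6), the ZERO cusp — reduction of the binder `h0` of GAP row G-L5d4g6-1.**
Under the printed claims of p. 38, the printed-shape law "`I_{ε⁰} ↠ Δ_ε⁺`", i.e.
`I_{ε⁰} ⊔ jKer = Δ_X̲` (the analogue for `ε⁰` of `ArrowCoveringClaims.inertia_ε1_sup`/`inertia_ε2_sup`;
in print: the product of the cusp-inertia generators of `Δ_X̲` is a commutator and `ι` fixes `ε⁰`),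
implies that `ε⁰` is ramified in `X̲→ → X̲`: `I_{ε⁰} ⊄ Π_{X→}`. ([IUTchI] Cor 1.2 p.39)
[claim: Mochizuki2012, status: disputed] -/
theorem ArrowCoveringClaims.not_inertia_ε0_le_piXarrow_of_sup (h : D.ArrowCoveringClaims)
    (h0 : D.inertia D.ε0 ⊔ D.jKer = D.DeltaXbar) : ¬ D.inertia D.ε0 ≤ D.piXarrow :=
  h.not_inertia_le_piXarrow_of_sup h0

/-- **Converse for prime `l`** (Cor. 1.2, proof p. 39 (s6)): under the printed claims of p. 38 with
`l` PRIME, a cusp `x` ramified in `X̲→ → X̲` [`I_x ⊄ Π_{X→}`] satisfies `I_x ⊔ jKer = Δ_X̲`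
[`I_x ↠ Δ_ε⁺ ≅ ℤ/l`]: the subgroup `I_x ⊔ jKer` lies between `jKer` and `Δ_X̲`, the index
`[Δ_X̲ : jKer] = l` is prime, and `I_x ⊔ jKer = jKer` would put `I_x` inside `jKer ⊆ Π_{X→}`.  So for
prime `l` the binder `h0` and the law of `not_inertia_ε0_le_piXarrow_of_sup` are EQUIVALENT.
([IUTchI] Cor 1.2 p.39) [claim: Mochizuki2012, status: disputed] -/
theorem ArrowCoveringClaims.inertia_sup_jKer_eq_of_not_le (h : D.ArrowCoveringClaims)
    (hl : D.l.Prime) {x : D.Cusp} (hx : ¬ D.inertia x ≤ D.piXarrow) :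
    D.inertia x ⊔ D.jKer = D.DeltaXbar := by
  have h1 : D.jKer ≤ D.inertia x ⊔ D.jKer := le_sup_right
  have h2 : D.inertia x ⊔ D.jKer ≤ D.DeltaXbar := sup_le (D.inertia_le_deltaXbar x) D.jKer_le_deltaXbar
  have hmul := Subgroup.relIndex_mul_relIndex D.jKer (D.inertia x ⊔ D.jKer) D.DeltaXbar h1 h2
  rw [h.jKer_relindex] at hmul
  rcases (Nat.dvd_prime hl).mp (Dvd.intro_left _ hmul) with h3 | h3
  · exact h2.antisymm (Subgroup.relIndex_eq_one.mp h3)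
  · exfalso
    have h4 : D.jKer.relIndex (D.inertia x ⊔ D.jKer) = 1 := by
      have h5 : D.jKer.relIndex (D.inertia x ⊔ D.jKer) * D.l = 1 * D.l := by
        rw [h3] at hmul; rw [hmul, one_mul]
      exact Nat.eq_of_mul_eq_mul_right hl.pos h5
    have h6 : D.inertia x ≤ D.jKer :=
      le_sup_left.trans (Subgroup.relIndex_eq_one.mp h4)
    exact hx (h6.trans (le_sup_right : D.jKer ≤ D.decomp D.twoε ⊔ D.jKer))

/-- **For prime `l`, the `ε⁰`-binder of GAP row G-L5d4g6-1 is equivalent to the printed-shape law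
`I_{ε⁰} ⊔ jKer = Δ_X̲`** (under the printed claims of p. 38). ([IUTchI] Cor 1.2 p.39)
[claim: Mochizuki2012, status: disputed] -/
theorem ArrowCoveringClaims.not_inertia_ε0_le_piXarrow_iff_sup (h : D.ArrowCoveringClaims)
    (hl : D.l.Prime) : ¬ D.inertia D.ε0 ≤ D.piXarrow ↔ D.inertia D.ε0 ⊔ D.jKer = D.DeltaXbar :=
  ⟨h.inertia_sup_jKer_eq_of_not_le hl, h.not_inertia_ε0_le_piXarrow_of_sup⟩

/-! ### Independence: the binder is not a consequence of the typed record and the typed claims -/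

namespace TrivialModel

/-- In the consistency model `toyDatum` (all typed §1 claims hold) the inertia group of the zero cusp
is trivial, hence contained in `Π_{X→}`: the `ε⁰`-clause of Cor. 1.2 (proof, p. 39) FAILS there.
([IUTchI] Cor 1.2 p.39) [claim: Mochizuki2012, status: disputed] -/
theorem inertia_ε0_le_piXarrow : toyDatum.inertia toyDatum.ε0 ≤ toyDatum.piXarrow := by
  rw [inertia_eq]
  exact (bot_le : (⊥ : Subgroup Amb) ≤ toyDatum.piXarrow)

/-- In `toyDatum` the printed-shape law `I_{ε⁰} ⊔ jKer = Δ_X̲` FAILS (both summands are trivial while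
`Δ_X̲ = 2ℤ/10`), consistently with the reduction theorem. ([IUTchI] Cor 1.2 p.39)
[claim: Mochizuki2012, status: disputed] -/
theorem inertia_ε0_sup_jKer_ne : toyDatum.inertia toyDatum.ε0 ⊔ toyDatum.jKer ≠ toyDatum.DeltaXbar :=
  fun h => arrowCoveringClaims.not_inertia_ε0_le_piXarrow_of_sup h inertia_ε0_le_piXarrow

end TrivialModel

/-- **INDEPENDENCE of the `ε⁰`-ramification binder (GAP row G-L5d4g6-1).** It is NOT the case that every
`PuncturedEllipticData` satisfying the typed printed claims of §1 — `ArrowCoveringClaims` (p. 38),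
`Rmk121` (p. 40) and the typed Corollary 1.2 `CharacteristicNatureOfCoverings D D` (p. 39) — has its
zero cusp ramified in `X̲→ → X̲`: the consistency model `toyDatum` satisfies all three and has
`I_{ε⁰} ≤ Π_{X→}`.  So the clause "whose image in `Gal(X̲→/X̲)` is nontrivial" for `ε⁰` is a genuinely
additional input on the typed record (kernel separation; says nothing about the printed curves).
([IUTchI] Cor 1.2 p.39) [claim: Mochizuki2012, status: disputed] -/
theorem not_forall_not_inertia_ε0_le_piXarrow :
    ¬ ∀ D : PuncturedEllipticData.{0}, D.ArrowCoveringClaims → D.Rmk121 →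
      D.CharacteristicNatureOfCoverings D → ¬ D.inertia D.ε0 ≤ D.piXarrow :=
  fun h => h TrivialModel.toyDatum TrivialModel.arrowCoveringClaims TrivialModel.rmk121
    TrivialModel.characteristicNatureOfCoverings TrivialModel.inertia_ε0_le_piXarrow

/-- Pointed form of the independence: a datum with all typed §1 claims and `I_{ε⁰} ⊆ Π_{X→}` EXISTS.
([IUTchI] Cor 1.2 p.39) [claim: Mochizuki2012, status: disputed] -/
theorem exists_claims_and_inertia_ε0_le_piXarrow :
    ∃ D : PuncturedEllipticData.{0}, D.ArrowCoveringClaims ∧ D.Rmk121 ∧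
      D.CharacteristicNatureOfCoverings D ∧ D.inertia D.ε0 ≤ D.piXarrow :=
  ⟨TrivialModel.toyDatum, TrivialModel.arrowCoveringClaims, TrivialModel.rmk121,
    TrivialModel.characteristicNatureOfCoverings, TrivialModel.inertia_ε0_le_piXarrow⟩

end PuncturedEllipticData

end Literature.IUT.HodgeTheaters
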